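import Summits.BirchSwinnertonDyer.BirchSwinnertonDyer.Theses.GenusKolyvaginAtTwo
import Summits.BirchSwinnertonDyer.Rank1Residual.F1Sign2.TwoAdicBSDRankOneAtTwo
import Literature.NumberTheory.EllipticCurves.CanonicalPAdicHeightSqExistenceProofs
import Literature.NumberTheory.EllipticCurves.LeadingTermPPartProofs
import Summits.BirchSwinnertonDyer.BirchSwinnertonDyer.Theorems.GenusKolyvaginAtTwoMinimalTwinBSDTwoOrdinaryTwist
import HarnessLib

/-!
# Crux `MinimalTwinBSDTwo` (route `GenusKolyvaginAtTwo`, item stmt-BirchSwinnertonDyer-22985): BRIDGE 5 —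
# on the good-ORDINARY-at-2 slice the rank-one input is the cell's per-curve 2-adic pair (K2-Gv, K2-G′v),
# with NO Tamagawa-parity, torsion or Galois-image binder

Cell `bsd-f1-sign2`, seat `bsd-line-gk2-p3` g6 (prover seat 3/3 on D-0145 line
`route-BirchSwinnertonDyer-GenusKolyvaginAtTwo`, OPEN rev 5). SUPPORT file for the crux
`Summit.BirchSwinnertonDyer.BirchSwinnertonDyer.Theses.GenusKolyvaginAtTwo.MinimalTwinBSDTwo` («BSD₂ for non-CM
`W/ℚ` of analytic rank `1` with `#Sel₂(W) = 2`»; `--supports stmt-BirchSwinnertonDyer-22985`). HONEST FRAMING: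
nothing here attacks the crux and BSD is not proved by any of this; every theorem is CONDITIONAL on displayed
hypotheses (three published named facts + the cell's conjecture-grade per-curve 2-adic statements). What is
recorded, kernel-checked, is a FIFTH placement of the crux (after gk2-p4's bridges 1–4,
`Theorems/GenusKolyvaginAtTwoMinimalTwinBSDTwoBridges.lean`), answering the caveat raised by seat gk2-p5 g2
(cell STATUS 2026-08-28T02:12Z): on the `Δ_E < 0` habitat every odd-`d_K` Heegner twin `E^{(d_K)}` has EVEN
Tamagawa product, so bridge 4 (item 23715 `RankOneAtTwoBigImageOddLocal`, which needs `∏ c_q` ODD) cannot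
supply the glue's rank-one input there. The typer's per-curve forms of the cell's K2 statements
(`Summit.BirchSwinnertonDyer.Rank1Residual.F1Sign2.TwoAdicBSDValRankOneAt W` = K2-Gv «the 2-adic norms of the
two sides of the Mazur–Tate–Teitelbaum leading-term formula agree, `#Ш[2^∞]` in place of `#Ш`», and
`…TwoAdicShaAnTransferRankOneAt W` = K2-G′v «`Reg₂ ≠ 0` and the archimedean `#Ш_an ∈ ℚ` satisfies the same
norm identity», file `Summits/BirchSwinnertonDyer/Rank1Residual/F1Sign2/TwoAdicBSDRankOneAtTwo.lean`, -es g5 /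
-ty g4) are SLICE-FREE: they carry no Tamagawa, torsion or image binder. The published glue `glue14Ord` used
«`∏ c_q` odd» only to know `∏ c_q ≠ 0`, which is the tree's `tamagawaProduct_pos_holds` (Silverman AEC
Cor. VII.6.2). Hence:

* §1 `bsdp_two_of_twoAdicAt` — for EVERY globally minimal `W/ℚ` that is good ordinary at `2` with
  `r_an(W) = 1`: K2-Gv-At(W) ∧ K2-G′v-At(W) + Gross–Zagier–Kolyvagin (`rank_eq_analyticRank_of_analyticRank_le_one`)
  + Mazur–Tate's `σ²` (`mazurTate_sigmaSq_existsUnique_two`, which inhabits the canonical `2`-adic height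
  receptacle at an ordinary `2`, `exists_isCanonicalSq_two`) + modularity as parametrisation data
  (`nonempty_modularParametrizationData`, which supplies the newform AND the rational period ratio `ϖ`,
  `ModularParametrizationData.exists_rat_mul_realPeriodRat_eq_plusPeriod`) ⟹ `BSDp W 2`. No parity of
  `∏ c_q`, no `#W(ℚ)_tors` odd, no `ρ̄_{W,2^n}` onto, no `#Sel₂`, no `¬CM`.
* §2 `minimalTwinBSDTwo_of_twoAdicAt_of_offOrdinary` — crux #6 BY NAME from the three facts, the per-curve
  pair on the ORDINARY-at-2 members of its class, and `BSDp` on the NON-ordinary members (supersingular,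
  multiplicative, additive at `2`: left as the displayed residue `hOff`; the cell's supersingular half needs the
  Dieudonné-valued Bernardi–Perrin-Riou statement, definition request D14-1 of -es §14, not typed).
* §3 `bsdp_two_twin_of_twoAdicAt` — ON THE ROUTE'S TWINS: for ANY globally minimal model `Wd` of a twist
  `E^{(d)}` (in the glue `d = d_K`), ordinary at `2` and of analytic rank `1`, the pair K2-Gv-At(Wd) ∧
  K2-G′v-At(Wd) gives `BSDp Wd 2` whatever the parity of `∏ c_q(Wd)` — in particular on the `Δ_E < 0`, `DEF = 1`
  twins with exactly one transposition prime `q ∣ d_K` (`c_q(Wd) = 2`). (Whether `Wd` is ordinary at `2` iff `E`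
  is — true for `d_K ≡ 1 (mod 4)`, an unramified twist at `2` — is NOT proved here; `IsOrdinaryAt Wd 2` is a
  displayed hypothesis.)
* §4 `rankOneAtTwoOrd_of_twoAdicAt` — the same reading for the PARENT residual: item 19099 `RankOneAtTwo`
  restricted to ordinary `2` follows from the per-curve pair class-wide; so on ordinary cells the odd-torsion /
  odd-Tamagawa / big-image clauses of 23715 are bookkeeping of the fkl LINE, not of the 2-adic statements.

READING for the pen (bsd-idea-1) / planner-of-record (-imc): on good-ordinary-at-2 cells the rank-one input
`hTw` of `closes` is EXACTLY the cell's K2-Gv ∧ K2-G′v for the twin (conjecture-grade at `2`, REF1 §55; the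
IMC₂ / 2-adic Gross–Zagier targets of the -es / -an lenses), with no side condition on `K`; crux #6 proper
(beyond those two statements) is needed only at supersingular / multiplicative / additive `2`.

References: Mazur–Tate–Teitelbaum, Invent. Math. 84 (1986) §I.11, §II [MazurTateTeitelbaum1986Invent];
Mazur–Stein–Tate 2006 §2.7 [MazurSteinTate2006]; R. L. Miller, LMS J. Comput. Math. 14 (2011) Def. 1.1
[Miller2011LMS]; Gross–Zagier 1986, Kolyvagin 1990 (rank part); Edixhoven 1991 §1 (period ratio).
-/

set_option autoImplicit false
set_option linter.dupNamespace false -- `Summit.BirchSwinnertonDyer.BirchSwinnertonDyer.…` is the tree's layout (D-0017)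

noncomputable section

open scoped Classical

namespace Summit.BirchSwinnertonDyer.BirchSwinnertonDyer.Theorems.MinimalTwinBSDTwo

open WeierstrassCurve WeierstrassCurve.PAdicHeightData Literature.NumberTheory.EllipticCurves
  Literature.NumberTheory.EllipticCurves.ModularForms
open Summit.BirchSwinnertonDyer.Rank1Residual.F1Sign2
open Summit.BirchSwinnertonDyer.BirchSwinnertonDyer.Theses

/-! ## §1 Slice-free glue: the per-curve 2-adic pair gives `BSD(W,2)` at an ordinary `2` in analytic rank one -/

/-- **Bridge 5 (per curve, slice-free).** For a globally minimal `W/ℚ`, good ordinary at `2`, of analytic rank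
`1`: the cell's per-curve 2-adic pair K2-Gv-At(W) (`TwoAdicBSDValRankOneAt W`) ∧ K2-G′v-At(W)
(`TwoAdicShaAnTransferRankOneAt W`), together with Gross–Zagier–Kolyvagin (`hGZK`), Mazur–Tate's `σ²` (`hMT`)
and modularity as parametrisation data (`hMod`), give Miller's `BSD(W,2)`. From the two norm identities
`‖A‖ = ‖ε·(#Ш[2^∞]·Reg₂·Tam)‖ = ‖ε·(q·Reg₂·Tam)‖` with `ε = (1 − α⁻¹)² ≠ 0`, `Reg₂ ≠ 0` (K2-G′v) and
`Tam ≠ 0` (`tamagawaProduct_pos_holds` — no parity needed) one reads `v₂(q) = v₂(#Ш[2^∞])`; rank and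
finiteness are GZK. CONDITIONAL; closes nothing. [cite: Miller2011LMS, Def. 1.1]
[cite: MazurTateTeitelbaum1986Invent, §I.11 and §II (leading-term conjecture, shape)] -/
theorem bsdp_two_of_twoAdicAt
    (hGZK : rank_eq_analyticRank_of_analyticRank_le_one)
    (hMT : mazurTate_sigmaSq_existsUnique_two)
    (hMod : nonempty_modularParametrizationData)
    (W : WeierstrassCurve ℚ) [W.IsElliptic] [W.IsGloballyMinimal]
    (hord : IsOrdinaryAt W 2) (har : W.analyticRank = 1)
    (hGv : TwoAdicBSDValRankOneAt W) (hG'v : TwoAdicShaAnTransferRankOneAt W) : BSDp W 2 := by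
  haveI : NeZero (W.conductorNorm ℤ) := ⟨(W.conductorNorm_pos_holds).ne'⟩
  have hle : W.analyticRank ≤ 1 := har.le
  obtain ⟨hrank, hfinSha⟩ := hGZK W hle
  haveI : Finite W.sha := hfinSha
  haveI hfin : Finite (AddCommGroup.primaryComponent W.sha 2) := inferInstance
  refine ⟨hrank, hfin, ?_⟩
  obtain ⟨Dt⟩ := hMod W
  obtain ⟨ϖ, -, hϖ, -⟩ := Dt.exists_rat_mul_realPeriodRat_eq_plusPeriod
  obtain ⟨D, hD⟩ := exists_isCanonicalSq_two hMT W hord.1 hord.2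
  have h1 := (hGv hord har D hD Dt.f Dt.isNewformOf).2 hfin ϖ hϖ
  obtain ⟨hReg, q, hq, h2⟩ := hG'v hord har D hD Dt.f Dt.isNewformOf ϖ hϖ
  refine ⟨q, hq, ?_⟩
  have h3 := h1.symm.trans h2
  have hε : (1 - (unitRoot W 2 : ℚ_[2])⁻¹) ^ 2 ≠ 0 :=
    pow_ne_zero _ (one_sub_unitRoot_inv_ne_zero W 2 hord)
  have hTam : (W.tamagawaProduct : ℚ_[2]) ≠ 0 := by
    exact_mod_cast (W.tamagawaProduct_pos_holds : 0 < W.tamagawaProduct).ne'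
  have hcard0 : Nat.card (AddCommGroup.primaryComponent W.sha 2) ≠ 0 := Nat.card_pos.ne'
  simp only [norm_mul] at h3
  have hε' : 0 < ‖(1 - (unitRoot W 2 : ℚ_[2])⁻¹) ^ 2‖ := norm_pos_iff.mpr hε
  have hR' : 0 < ‖padicRegulator D‖ := norm_pos_iff.mpr hReg
  have hT' : 0 < ‖(W.tamagawaProduct : ℚ_[2])‖ := norm_pos_iff.mpr hTam
  have h5 := mul_left_cancel₀ hε'.ne' h3
  have h6 := mul_right_cancel₀ hT'.ne' h5
  have h4 : ‖((Nat.card (AddCommGroup.primaryComponent W.sha 2) : ℕ) : ℚ_[2])‖ = ‖((q : ℚ) : ℚ_[2])‖ :=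
    mul_right_cancel₀ hR'.ne' h6
  exact padicValRat_eq_padicValNat_of_norm_eq hcard0 h4

/-! ## §2 Crux #6 by name: the ordinary slice from the per-curve pair, the non-ordinary slice displayed -/

/-- **Crux #6 `MinimalTwinBSDTwo` BY NAME** from: the three published facts; the per-curve 2-adic pair on every
ORDINARY-at-2 member of its class (non-CM, `r_an = 1`, `#Sel₂ = 2`); and `BSDp W 2` on the NON-ordinary
members (`hOff`, displayed: supersingular, multiplicative or additive reduction at `2`). No Tamagawa-parity /
torsion / image clause appears. CONDITIONAL; closes nothing. [cite: Miller2011LMS, Def. 1.1] -/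
theorem minimalTwinBSDTwo_of_twoAdicAt_of_offOrdinary
    (hGZK : rank_eq_analyticRank_of_analyticRank_le_one)
    (hMT : mazurTate_sigmaSq_existsUnique_two)
    (hMod : nonempty_modularParametrizationData)
    (hOrd : ∀ (W : WeierstrassCurve ℚ) [W.IsElliptic] [W.IsGloballyMinimal], ¬ W.HasCM →
      W.analyticRank = 1 → Nat.card (W.selmerGroup 2) = 2 → IsOrdinaryAt W 2 →
      TwoAdicBSDValRankOneAt W ∧ TwoAdicShaAnTransferRankOneAt W)
    (hOff : ∀ (W : WeierstrassCurve ℚ) [W.IsElliptic] [W.IsGloballyMinimal], ¬ W.HasCM →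
      W.analyticRank = 1 → Nat.card (W.selmerGroup 2) = 2 → ¬ IsOrdinaryAt W 2 → BSDp W 2) :
    GenusKolyvaginAtTwo.MinimalTwinBSDTwo := by
  intro W _ _ hcm har hSel
  by_cases hord : IsOrdinaryAt W 2
  · obtain ⟨hGv, hG'v⟩ := hOrd W hcm har hSel hord
    exact bsdp_two_of_twoAdicAt hGZK hMT hMod W hord har hGv hG'v
  · exact hOff W hcm har hSel hord

/-- **The ordinary slice of crux #6, displayed on the crux's own binders** (the `¬CM` and `#Sel₂` binders are
idle): non-CM `W`, `r_an(W) = 1`, `#Sel₂(W) = 2`, `W` good ordinary at `2`, K2-Gv-At(W), K2-G′v-At(W) ⟹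
`BSDp W 2`, granted the three facts. [cite: Miller2011LMS, Def. 1.1] -/
theorem minimalTwinBSDTwo_ordSlice_of_twoAdicAt
    (hGZK : rank_eq_analyticRank_of_analyticRank_le_one)
    (hMT : mazurTate_sigmaSq_existsUnique_two)
    (hMod : nonempty_modularParametrizationData) :
    ∀ (W : WeierstrassCurve ℚ) [W.IsElliptic] [W.IsGloballyMinimal], ¬ W.HasCM → W.analyticRank = 1 →
      Nat.card (W.selmerGroup 2) = 2 → IsOrdinaryAt W 2 →
      TwoAdicBSDValRankOneAt W → TwoAdicShaAnTransferRankOneAt W → BSDp W 2 :=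
  fun W _ _ _ har _ hord hGv hG'v ↦ bsdp_two_of_twoAdicAt hGZK hMT hMod W hord har hGv hG'v

/-! ## §3 On the route's twins: no parity condition on `∏ c_q(Wd)` -/

/-- **Bridge 5 on the glue's twin.** For ANY globally minimal `ℚ`-model `Wd` of a quadratic twist `E^{(d)}`
(in the route `d = d_K`, `Wd` the model the supply crux #2 produces) that is good ordinary at `2` and of
analytic rank `1`: K2-Gv-At(Wd) ∧ K2-G′v-At(Wd) + the three facts ⟹ `BSDp Wd 2` — whatever the parity of
`∏ c_q(Wd)`; in particular on the `Δ_E < 0` habitat, where every odd-`d_K` twin has even Tamagawa product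
(one transposition prime `q ∣ d_K`, `c_q(Wd) = 2`, seat gk2-p5), this is the rank-one input `hTw` of `closes`
for ordinary cells. The twist hypothesis is carried only to display the route's shape (it is not used:
§1 is about `Wd` alone). [cite: Miller2011LMS, Def. 1.1] -/
theorem bsdp_two_twin_of_twoAdicAt
    (hGZK : rank_eq_analyticRank_of_analyticRank_le_one)
    (hMT : mazurTate_sigmaSq_existsUnique_two)
    (hMod : nonempty_modularParametrizationData)
    (W : WeierstrassCurve ℚ) (d : ℚ)
    (Wd : WeierstrassCurve ℚ) [Wd.IsElliptic] [Wd.IsGloballyMinimal]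
    (_hWd : ∃ C : VariableChange ℚ, C • W.quadraticTwist d = Wd)
    (hord : IsOrdinaryAt Wd 2) (hard : Wd.analyticRank = 1)
    (hGv : TwoAdicBSDValRankOneAt Wd) (hG'v : TwoAdicShaAnTransferRankOneAt Wd) : BSDp Wd 2 :=
  bsdp_two_of_twoAdicAt hGZK hMT hMod Wd hord hard hGv hG'v

/-! ## §4 The parent residual 19099 on ordinary cells -/

/-- **Item 19099 `RankOneAtTwo` restricted to ordinary `2`** follows class-wide from the per-curve pair and the
three facts: for every non-CM globally minimal `W` of analytic rank `1` that is good ordinary at `2`,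
K2-Gv-At(W) ∧ K2-G′v-At(W) ⟹ `BSDp W 2`. So on ordinary cells the extra clauses of the child 23715 (big
`2`-adic image, odd torsion, odd Tamagawa) belong to the fkl LINE's mechanism, not to the 2-adic statements
themselves. CONDITIONAL; closes nothing. [cite: Miller2011LMS, Def. 1.1] -/
theorem rankOneAtTwo_ordSlice_of_twoAdicAt
    (hGZK : rank_eq_analyticRank_of_analyticRank_le_one)
    (hMT : mazurTate_sigmaSq_existsUnique_two)
    (hMod : nonempty_modularParametrizationData)
    (hOrd : ∀ (W : WeierstrassCurve ℚ) [W.IsElliptic] [W.IsGloballyMinimal], ¬ W.HasCM →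
      W.analyticRank = 1 → IsOrdinaryAt W 2 → TwoAdicBSDValRankOneAt W ∧ TwoAdicShaAnTransferRankOneAt W) :
    ∀ (W : WeierstrassCurve ℚ) [W.IsElliptic] [W.IsGloballyMinimal], ¬ W.HasCM → W.analyticRank = 1 →
      IsOrdinaryAt W 2 → BSDp W 2 := by
  intro W _ _ hcm har hord
  obtain ⟨hGv, hG'v⟩ := hOrd W hcm har hord
  exact bsdp_two_of_twoAdicAt hGZK hMT hMod W hord har hGv hG'v

/-! ## §5 (appended) The Heegner twin of an ORDINARY habitat curve: ordinarity transported, no parity of `∏ c_q(Wd)` -/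

/-- **Bridge 5 on the glue's twin, read off the HABITAT curve.** `E` (globally minimal model `W`) good ordinary at
`2`; `K` a quadratic field with ODD discriminant (the route's Heegner fields: `d_K` odd by crux #2's binder, so
`d_K ≡ 1 (mod 4)` and the twist is unramified at `2`); `Wd` ANY globally minimal model of `E^{(d_K)}` with
`r_an(Wd) = 1`. Then `Wd` is good ordinary at `2` (`OrdinaryTwistAtTwo.isOrdinaryAt_two_twin_iff_of_odd_discr`,
file `…MinimalTwinBSDTwoOrdinaryTwist.lean`), so the per-curve pair K2-Gv-At(Wd) ∧ K2-G′v-At(Wd) + the three facts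
give `BSDp Wd 2` (§1) — whatever the parity of `∏ c_q(Wd)`, in particular on the `Δ_E < 0` / `DEF = 1` twins where
item 23715 cannot serve (gk2-p5, `…HeegnerTwinParity.lean`). So on every good-ORDINARY-at-2 cell of the habitat the
rank-one input `hTw` of `closes` is exactly the cell's K2 pair for the twin. CONDITIONAL on the displayed
hypotheses; closes nothing. [cite: Miller2011LMS, Def. 1.1] [cite: SilvermanAEC2009, V.4 and X.2 Prop. 2.4] -/
theorem bsdp_two_heegnerTwin_of_twoAdicAt_of_isOrdinaryAt
    (hGZK : rank_eq_analyticRank_of_analyticRank_le_one)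
    (hMT : mazurTate_sigmaSq_existsUnique_two)
    (hMod : nonempty_modularParametrizationData)
    (W : WeierstrassCurve ℚ) [W.IsElliptic] [W.IsGloballyMinimal] (hord : IsOrdinaryAt W 2)
    (K : Type) [Field K] [NumberField K] (h2 : Module.finrank ℚ K = 2) (hodd : Odd (NumberField.discr K))
    (Wd : WeierstrassCurve ℚ) [Wd.IsElliptic] [Wd.IsGloballyMinimal]
    (hWd : ∃ C : VariableChange ℚ, C • W.quadraticTwist (NumberField.discr K : ℚ) = Wd)
    (hard : Wd.analyticRank = 1)
    (hGv : TwoAdicBSDValRankOneAt Wd) (hG'v : TwoAdicShaAnTransferRankOneAt Wd) : BSDp Wd 2 :=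
  bsdp_two_of_twoAdicAt hGZK hMT hMod Wd
    ((OrdinaryTwistAtTwo.isOrdinaryAt_two_twin_iff_of_odd_discr W K h2 hodd Wd hWd).mpr hord) hard hGv hG'v

/-- **The same in the route's own binder currency** (`IsImaginaryQuadratic K`, `Odd (discr K)` — verbatim the
clauses of cruxes #2–#4): for `E` on a good-ORDINARY-at-2 cell of the habitat and its Heegner twin `Wd`, the
per-curve 2-adic pair for `Wd` is the rank-one input. [cite: Miller2011LMS, Def. 1.1] -/
theorem bsdp_two_heegnerTwin_of_twoAdicAt_of_isOrdinaryAt'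
    (hGZK : rank_eq_analyticRank_of_analyticRank_le_one)
    (hMT : mazurTate_sigmaSq_existsUnique_two)
    (hMod : nonempty_modularParametrizationData)
    (W : WeierstrassCurve ℚ) [W.IsElliptic] [W.IsGloballyMinimal] (hord : IsOrdinaryAt W 2)
    (K : Type) [Field K] [NumberField K] (hK : IsImaginaryQuadratic K) (hodd : Odd (NumberField.discr K))
    (Wd : WeierstrassCurve ℚ) [Wd.IsElliptic] [Wd.IsGloballyMinimal]
    (hWd : ∃ C : VariableChange ℚ, C • W.quadraticTwist (NumberField.discr K : ℚ) = Wd)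
    (hard : Wd.analyticRank = 1)
    (hGv : TwoAdicBSDValRankOneAt Wd) (hG'v : TwoAdicShaAnTransferRankOneAt Wd) : BSDp Wd 2 :=
  bsdp_two_heegnerTwin_of_twoAdicAt_of_isOrdinaryAt hGZK hMT hMod W hord K hK.1 hodd Wd hWd hard hGv hG'v

/-! ## §6 (appended) Unbundling K2-G′v: an EXACT rank-one 2-adic leading-term identity with `#Ш_an`
(Disegni 2020 Thm. 1 shape — printed for EVERY ordinary prime, `p = 2` included) + Schneider non-degeneracy at `2` -/

/-- **K2-G′v-At from an EXACT identity.** If, for `W` good ordinary at `2` of analytic rank one, (i) the canonical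
`σ²` `2`-adic regulator is non-zero for every canonical datum (Schneider's non-degeneracy at `2`, rank one — OPEN), and
(ii) `#Ш_an(W)` is a rational `q` satisfying the EXACT Mazur–Tate–Teitelbaum rank-one identity
`ϖ·[T¹]L₂(f,α)·log₂γ·#tors² = (1 − α⁻¹)²·q·Reg₂(D)·∏c_v` for every canonical `σ²`-datum `D`, newform `f` and period
ratio `ϖ` — the shape of Disegni's Conjecture `(BSD_p)` with `|Ш|_an`, which is his THEOREM 1 (Kyoto J. Math. 60
(2020); arXiv:1609.02528 p. 5, Thm. 1; Thm. 4 first bullet, §3.2) for `E/ℚ` with ORDINARY (good or non-split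
multiplicative) reduction at ANY prime `p` and `r_an ≤ 1` (proof: his `p`-adic Gross–Zagier formula, Compositio 153
(2017) Thm. B, «fix a rational prime p» — no parity hypothesis; the tree vendors the multiplicative case for `p ≠ 2`
only, `Disegni2020.padicBSD_nonsplitMult_rankOne`, flag «printed for every prime of ordinary reduction») — then
the cell's per-curve K2-G′v-At(W) holds (norms of equal things are equal). So, modulo the typer's height/period
currency at `2` (`IsCanonicalSq` = the Mazur–Tate canonical height = Nekovář's `h^can` = Schneider's `h^norm` at a
good ordinary prime), K2-G′v on ordinary cells = PRINT (Disegni) ∧ «`Reg₂ ≠ 0`» (open). Nothing is asserted here: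
both (i) and (ii) are displayed hypotheses. [cite: Disegni2020, Thm. 1 and Thm. 4 (first bullet), §3.2.1]
[cite: MazurTateTeitelbaum1986Invent, §II (leading-term conjecture, shape)] -/
theorem twoAdicShaAnTransferRankOneAt_of_exact (W : WeierstrassCurve ℚ) [W.IsElliptic] [W.IsGloballyMinimal]
    (hReg : ∀ D : PAdicHeightData W 2, D.IsCanonicalSq → padicRegulator D ≠ 0)
    (hEx : IsOrdinaryAt W 2 → W.analyticRank = 1 → ∃ q : ℚ, shaAn W = (q : ℂ) ∧
      ∀ D : PAdicHeightData W 2, D.IsCanonicalSq →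
      ∀ ⦃N : ℕ⦄ [NeZero N] (f : CuspForm (CongruenceSubgroup.Gamma0 N) 2), IsNewformOf W f →
      ∀ ϖ : ℚ, (ϖ : ℝ) * W.realPeriodRat = plusPeriod f →
        (ϖ : ℚ_[2]) * PowerSeries.coeff 1 (padicLFunction f (unitRoot W 2 : ℚ_[2])) *
            padicLog 2 (cyclotomicGenerator 2) * (W.torsionOrder : ℚ_[2]) ^ 2 =
          (1 - (unitRoot W 2 : ℚ_[2])⁻¹) ^ 2 * ((q : ℚ_[2]) * padicRegulator D * W.tamagawaProduct)) :
    TwoAdicShaAnTransferRankOneAt W := by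
  intro hord har D hD N _ f hf ϖ hϖ
  obtain ⟨q, hq, hid⟩ := hEx hord har
  exact ⟨hReg D hD, q, hq, congrArg _ (hid D hD f hf ϖ hϖ)⟩

/-- **Crux #6 on an ordinary cell, residue made explicit.** For `W` globally minimal, good ordinary at `2`,
`r_an(W) = 1`: K2-Gv-At(W) (the `#Ш[2^∞]` leading-term norm identity — the IMC₂ target, OPEN) + Schneider's
non-degeneracy at `2` (OPEN) + the exact `#Ш_an` identity of Disegni's shape (PRINT for every ordinary prime,
Disegni 2020 Thm. 1, modulo the height currency at `2`) + GZK + Mazur–Tate `σ²` + BCDT ⟹ `BSDp W 2`. So after this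
the open content of crux #6 on good-ordinary twins is «K2-Gv ∧ Reg₂ ≠ 0», no longer «K2-Gv ∧ K2-G′v».
CONDITIONAL; closes nothing. [cite: Disegni2020, Thm. 1] [cite: Miller2011LMS, Def. 1.1] -/
theorem bsdp_two_of_twoAdicVal_of_exact
    (hGZK : rank_eq_analyticRank_of_analyticRank_le_one)
    (hMT : mazurTate_sigmaSq_existsUnique_two)
    (hMod : nonempty_modularParametrizationData)
    (W : WeierstrassCurve ℚ) [W.IsElliptic] [W.IsGloballyMinimal]
    (hord : IsOrdinaryAt W 2) (har : W.analyticRank = 1)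
    (hGv : TwoAdicBSDValRankOneAt W)
    (hReg : ∀ D : PAdicHeightData W 2, D.IsCanonicalSq → padicRegulator D ≠ 0)
    (hEx : ∃ q : ℚ, shaAn W = (q : ℂ) ∧
      ∀ D : PAdicHeightData W 2, D.IsCanonicalSq →
      ∀ ⦃N : ℕ⦄ [NeZero N] (f : CuspForm (CongruenceSubgroup.Gamma0 N) 2), IsNewformOf W f →
      ∀ ϖ : ℚ, (ϖ : ℝ) * W.realPeriodRat = plusPeriod f →
        (ϖ : ℚ_[2]) * PowerSeries.coeff 1 (padicLFunction f (unitRoot W 2 : ℚ_[2])) *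
            padicLog 2 (cyclotomicGenerator 2) * (W.torsionOrder : ℚ_[2]) ^ 2 =
          (1 - (unitRoot W 2 : ℚ_[2])⁻¹) ^ 2 * ((q : ℚ_[2]) * padicRegulator D * W.tamagawaProduct)) :
    BSDp W 2 :=
  bsdp_two_of_twoAdicAt hGZK hMT hMod W hord har hGv
    (twoAdicShaAnTransferRankOneAt_of_exact W hReg fun _ _ ↦ hEx)

end Summit.BirchSwinnertonDyer.BirchSwinnertonDyer.Theorems.MinimalTwinBSDTwo

end
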